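import Literature.Analysis.ODE.LinearComparison
import Mathlib.Analysis.SpecialFunctions.Integrals.Basic
import HarnessLib

/-!
# Tao's cascade ODE, §6.7 "dynamics at the zero scale", II: exponential growth and decay lemmas

T. Tao, *Finite time blowup for an averaged three-dimensional Navier–Stokes equation*,
J. Amer. Math. Soc. **29** (2016), 601–674 = arXiv:1402.0290v3, §6.7 (equation numbers of arXiv v3).
The second group of steps of §6.7 consists of one-sided Grönwall arguments for the *linear*
equation `∂ₜc = λ a² + (ε⁻¹K^{10} b) c + O(δ)` satisfied by the modes `c₀` ((6.131)) and `c₋₁`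
((6.136)), in which the rate `ε⁻¹K^{10} b(t)` is known from the preceding steps:

* the lower bound "`c₀(t) ≳ exp((t²/2 - 10⁻⁵t - 1 + O(K⁻⁹))K^{10}) ε²` whenever `1/2 ≤ t ≤ t_c`"
  (display before (6.158)), from `∂ₜc₀ ≥ (1+O(K⁻⁹)) ε² e^{-K^{10}} + ε⁻¹K^{10} b₀ c₀` and the
  two-sided affine bound (6.157) on `b₀` — here `c_lower_of_affine_rate`, with the window `w`,
  the offsets and all constants explicit;
* exponential growth from a positive value, "(6.163) `c₀(t) ≥ K^{-10}ε²` … (6.164)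
  `∂ₜc₀ ≳ K^{10}c₀` … (6.165) `c₀(t) ≥ K^{100}ε²`" and likewise (6.171) for `c₋₁` — here
  `exp_growth_lower` (`g' ≥ β g - η`, `β ≥ β₀ ≥ 0` gives `g(t) ≥ e^{β₀(t-a)}(g(a) - η(t-a))`);
* exponential upper bounds "(6.166) `∂ₜc₀ ≲ K^{10}c₀` … (6.167) `c₀ ≲ exp(O(K^{10-1/2}))ε²`" and
  (6.169) — here `le_exp_growth` (`g' ≤ β g + r`, `β ≤ β₁`, `r ≥ 0`).

All statements are stand-alone real-variable theorems (functions continuous on `[a, b]` with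
right derivatives, as in `Literature/Analysis/ODE/LinearComparison.lean`, whose
variable-coefficient comparison theorems `le_linearComparison` / `linearComparison_le` they
specialise), so that they can be instantiated inside any packaging of the bootstrap of §6.5–6.7.

## References

* T. Tao, J. Amer. Math. Soc. 29 (2016), 601–674, arXiv:1402.0290v3, §6.7 (6.157)–(6.158),
  (6.163)–(6.167), (6.169)–(6.171). [`Tao2016AveragedNS`]
* P. Hartman, *Ordinary Differential Equations*, 2nd ed., SIAM 2002, Ch. III §1. [folklore]
-/

noncomputable section

open Set MeasureTheory intervalIntegral Filter Topology

namespace Literature.Analysis.FluidPDE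

namespace TaoCascade

open Literature.Analysis.ODE

/-! ## Primitives of continuous rates -/

/-- The primitive `B(s) = ∫_a^s β` of a rate continuous on `[a, b]` is continuous on `[a, b]`.
[folklore] -/
theorem continuousOn_primitive_Icc {a b : ℝ} {β : ℝ → ℝ} (hβ : ContinuousOn β (Icc a b)) :
    ContinuousOn (fun s => ∫ u in a..s, β u) (Icc a b) := by
  rcases le_or_gt a b with hab | hab
  · have h := intervalIntegral.continuousOn_primitive_interval' (μ := volume) (f := β)
      (b₁ := a) (b₂ := b) (a := a) (hβ.intervalIntegrable_of_Icc hab) (by simp [hab])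
    simpa [uIcc_of_le hab] using h
  · intro s hs
    exact absurd (hs.1.trans hs.2) (not_le.2 hab)

/-- Monotonicity of the primitive under a pointwise bound: if `ℓ ≤ β` on `[a, s]` (both
continuous on `[a, b]`, `s ∈ [a, b]`) then `∫_a^s ℓ ≤ ∫_a^s β`. [folklore] -/
theorem primitive_mono {a b s : ℝ} {β ℓ : ℝ → ℝ} (hβ : ContinuousOn β (Icc a b))
    (hℓ : ContinuousOn ℓ (Icc a b)) (hs : s ∈ Icc a b) (h : ∀ u ∈ Icc a s, ℓ u ≤ β u) :
    ∫ u in a..s, ℓ u ≤ ∫ u in a..s, β u :=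
  integral_mono_on hs.1 ((hℓ.mono (Icc_subset_Icc le_rfl hs.2)).intervalIntegrable_of_Icc hs.1)
    ((hβ.mono (Icc_subset_Icc le_rfl hs.2)).intervalIntegrable_of_Icc hs.1) h

/-- The primitive of the affine function `σ (u - a) + p` from `a` to `s`:
`σ (s-a)²/2 + p (s-a)`. [folklore] -/
theorem integral_affine (a s σ p : ℝ) :
    ∫ u in a..s, (σ * (u - a) + p) = σ * (s - a) ^ 2 / 2 + p * (s - a) := by
  have h1 : IntervalIntegrable (fun u : ℝ => σ * u) volume a s :=
    (continuous_const.mul continuous_id).intervalIntegrable _ _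
  have h2 : IntervalIntegrable (fun _ : ℝ => p - σ * a) volume a s :=
    continuous_const.intervalIntegrable _ _
  have : (fun u => σ * (u - a) + p) = fun u => σ * u + (p - σ * a) := by ext u; ring
  rw [this, intervalIntegral.integral_add h1 h2, intervalIntegral.integral_const_mul, integral_id,
    intervalIntegral.integral_const, smul_eq_mul]
  ring

/-! ## Exponential growth from below and from above -/

/-- **Exponential growth from below** ((6.163)–(6.165), (6.171)): if `g` is continuous on
`[a, b]` with right derivative `g'`, `β` is continuous with `β ≥ β₀ ≥ 0` on `[a, b]`, `η ≥ 0`,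
`g' ≥ β g - η` on `[a, b)`, and `g(a) ≥ η (t - a)`, then `g(t) ≥ e^{β₀ (t-a)} (g(a) - η (t-a))`.
[cite: Tao2016AveragedNS, §6.7 (6.163)–(6.165)] -/
theorem exp_growth_lower {a b : ℝ} {g g' β : ℝ → ℝ} {β₀ η : ℝ}
    (hg : ContinuousOn g (Icc a b)) (hg' : ∀ t ∈ Ico a b, HasDerivWithinAt g (g' t) (Ici t) t)
    (hβ : ContinuousOn β (Icc a b)) (hβ0 : 0 ≤ β₀) (hββ : ∀ t ∈ Icc a b, β₀ ≤ β t) (hη : 0 ≤ η)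
    (bound : ∀ t ∈ Ico a b, β t * g t - η ≤ g' t) {t : ℝ} (ht : t ∈ Icc a b)
    (hga : η * (t - a) ≤ g a) :
    Real.exp (β₀ * (t - a)) * (g a - η * (t - a)) ≤ g t := by
  have hcomp := linearComparison_le hg hg' (A := fun _ => -η) continuousOn_const hβ
    (fun s hs => by have := bound s hs; linarith) ht
  set B : ℝ → ℝ := fun s => ∫ u in a..s, β u with hB
  -- `B ≥ 0` and `B t ≥ β₀ (t - a)`
  have hBnn : ∀ s ∈ Icc a t, 0 ≤ B s := fun s hs =>
    integral_nonneg hs.1 fun u hu => hβ0.trans (hββ u ⟨hu.1, hu.2.trans (hs.2.trans ht.2)⟩)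
  have hBt : β₀ * (t - a) ≤ B t := by
    have := primitive_mono hβ continuousOn_const ht (ℓ := fun _ => β₀)
      (fun u hu => hββ u ⟨hu.1, hu.2.trans ht.2⟩)
    simpa [hB, mul_comm] using this
  -- the forcing integral is at least `-η (t - a)`
  have hBc : ContinuousOn B (Icc a b) := continuousOn_primitive_Icc hβ
  have hwc : ContinuousOn (fun s => (fun _ : ℝ => -η) s * Real.exp (-B s)) (Icc a t) :=
    continuousOn_const.mul ((hBc.mono (Icc_subset_Icc le_rfl ht.2)).neg.rexp)
  have hint : -η * (t - a) ≤ ∫ s in a..t, (fun _ : ℝ => -η) s * Real.exp (-B s) := by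
    have h1 : ∫ s in a..t, (fun _ : ℝ => -η) s * (1 : ℝ) ≤
        ∫ s in a..t, (fun _ : ℝ => -η) s * Real.exp (-B s) := by
      apply integral_mono_on ht.1 (by simp)
        (hwc.intervalIntegrable_of_Icc ht.1)
      intro s hs
      have hle : Real.exp (-B s) ≤ 1 := by
        rw [Real.exp_le_one_iff]; linarith [hBnn s hs]
      show -η * 1 ≤ -η * Real.exp (-B s)
      nlinarith [Real.exp_pos (-B s)]
    have h2 : ∫ s in a..t, (fun _ : ℝ => -η) s * (1 : ℝ) = -η * (t - a) := by
      simp only [mul_one, intervalIntegral.integral_const, smul_eq_mul]; ring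
    linarith
  have hX : 0 ≤ g a - η * (t - a) := by linarith
  calc Real.exp (β₀ * (t - a)) * (g a - η * (t - a))
      ≤ Real.exp (B t) * (g a - η * (t - a)) :=
        mul_le_mul_of_nonneg_right (Real.exp_le_exp.2 hBt) hX
    _ ≤ Real.exp (B t) * (g a + ∫ s in a..t, (fun _ : ℝ => -η) s * Real.exp (-B s)) := by
        apply mul_le_mul_of_nonneg_left _ (Real.exp_pos _).le
        linarith
    _ ≤ g t := hcomp

/-- **Exponential growth from above** ((6.166)–(6.167), (6.169)): if `g` is continuous on
`[a, b]` with right derivative `g'`, `β` continuous with `β ≤ β₁` on `[a, b]`, `0 ≤ β₁`, `r ≥ 0`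
continuous, `g' ≤ β g + r` on `[a, b)` and `g(a) ≥ 0`, then
`g(t) ≤ e^{β₁ (t-a)} (g(a) + ∫_a^t r)`. [cite: Tao2016AveragedNS, §6.7 (6.166)–(6.167)] -/
theorem le_exp_growth {a b : ℝ} {g g' β r : ℝ → ℝ} {β₁ : ℝ}
    (hg : ContinuousOn g (Icc a b)) (hg' : ∀ t ∈ Ico a b, HasDerivWithinAt g (g' t) (Ici t) t)
    (hβ : ContinuousOn β (Icc a b)) (hβ1 : 0 ≤ β₁) (hββ : ∀ t ∈ Icc a b, β t ≤ β₁)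
    (hr : ContinuousOn r (Icc a b)) (hr0 : ∀ t ∈ Icc a b, 0 ≤ r t)
    (bound : ∀ t ∈ Ico a b, g' t ≤ β t * g t + r t) {t : ℝ} (ht : t ∈ Icc a b) (hga : 0 ≤ g a) :
    g t ≤ Real.exp (β₁ * (t - a)) * (g a + ∫ s in a..t, r s) := by
  have hcomp := le_linearComparison hg hg' hr hβ (fun s hs => by have := bound s hs; linarith) ht
  set B : ℝ → ℝ := fun s => ∫ u in a..s, β u with hB
  have hBc : ContinuousOn B (Icc a b) := continuousOn_primitive_Icc hβ
  have hβi : ∀ {x y : ℝ}, a ≤ x → x ≤ y → y ≤ b → IntervalIntegrable β volume x y :=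
    fun hx hxy hy => (hβ.mono (Icc_subset_Icc hx hy)).intervalIntegrable_of_Icc hxy
  -- `B t - B s ≤ β₁ (t - s)` for `a ≤ s ≤ t`
  have hBdiff : ∀ s ∈ Icc a t, B t - B s ≤ β₁ * (t - s) := by
    intro s hs
    have hsplit : B t - B s = ∫ u in s..t, β u := by
      simp only [hB]
      rw [← integral_add_adjacent_intervals (hβi le_rfl hs.1 (hs.2.trans ht.2))
        (hβi hs.1 hs.2 ht.2)]
      ring
    rw [hsplit]
    have := integral_mono_on hs.2 (hβi hs.1 hs.2 ht.2)
      ((continuous_const (y := β₁)).intervalIntegrable s t)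
      (fun u hu => hββ u ⟨hs.1.trans hu.1, hu.2.trans ht.2⟩)
    simpa [mul_comm] using this
  have hBt : B t ≤ β₁ * (t - a) := by
    have := hBdiff a ⟨le_rfl, ht.1⟩
    simpa [hB] using this
  have hint0 : 0 ≤ ∫ s in a..t, r s :=
    integral_nonneg ht.1 fun s hs => hr0 s ⟨hs.1, hs.2.trans ht.2⟩
  -- compare the weighted integral
  have hwc : ContinuousOn (fun s => r s * Real.exp (-B s)) (Icc a t) :=
    (hr.mono (Icc_subset_Icc le_rfl ht.2)).mul ((hBc.mono (Icc_subset_Icc le_rfl ht.2)).neg.rexp)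
  have hint : Real.exp (B t) * ∫ s in a..t, r s * Real.exp (-B s) ≤
      Real.exp (β₁ * (t - a)) * ∫ s in a..t, r s := by
    rw [← intervalIntegral.integral_const_mul, ← intervalIntegral.integral_const_mul]
    apply integral_mono_on ht.1 ((hwc.intervalIntegrable_of_Icc ht.1).const_mul _)
      (((hr.mono (Icc_subset_Icc le_rfl ht.2)).intervalIntegrable_of_Icc ht.1).const_mul _)
    intro s hs
    have hrs := hr0 s ⟨hs.1, hs.2.trans ht.2⟩
    have hexp : Real.exp (B t) * Real.exp (-B s) ≤ Real.exp (β₁ * (t - a)) := by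
      rw [← Real.exp_add, Real.exp_le_exp]
      have := hBdiff s hs
      nlinarith [hs.1, hs.2]
    calc Real.exp (B t) * (r s * Real.exp (-B s)) = (Real.exp (B t) * Real.exp (-B s)) * r s := by
          ring
      _ ≤ Real.exp (β₁ * (t - a)) * r s := mul_le_mul_of_nonneg_right hexp hrs
  calc g t ≤ Real.exp (B t) * (g a + ∫ s in a..t, r s * Real.exp (-B s)) := hcomp
    _ = Real.exp (B t) * g a + Real.exp (B t) * ∫ s in a..t, r s * Real.exp (-B s) := by ring
    _ ≤ Real.exp (β₁ * (t - a)) * g a + Real.exp (β₁ * (t - a)) * ∫ s in a..t, r s := by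
        gcongr
    _ = Real.exp (β₁ * (t - a)) * (g a + ∫ s in a..t, r s) := by ring

/-! ## The explicit lower bound for `c₀` before `t_c` -/

/-- **The lower bound for `c₀` on `[1/2, t_c]`** (display before (6.158): "by (6.57), (6.157) and
Gronwall's inequality we see that `c₀(t) ≳ exp((t²/2 - 10⁻⁵t - 1 + O(K⁻⁹))K^{10}) ε²`"), as a
stand-alone statement. Let `c` be continuous on `[a, b]` with right derivative `c'`, `b₀`
continuous, `μ ≥ 0`, and on `[a, b)` let `c' ≥ λ₀ + μ b₀ c - η₂` (the `c₀`-equation (6.131) with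
`λ₀ ≤ ε² e^{-K^{10}} a₀²`), with the affine bounds `σ(s-a) - p ≤ b₀(s) ≤ σ(s-a) + p` ((6.157)),
`σ, p ≥ 0`, `c(a) ≥ -η'` ((6.57)) and `η₂ ≤ λ₀`. Then for `t ∈ [a, b]` and any window
`0 < w ≤ t - a`,
`c(t) ≥ exp(μ(σ(t-a)²/2 - p(t-a))) · ((λ₀ - η₂) w exp(-μ(σw²/2 + pw)) - η')` provided the last
factor is nonnegative. [cite: Tao2016AveragedNS, §6.7 (6.157)–(6.158)] -/
theorem c_lower_of_affine_rate {a b : ℝ} {c c' b₀ : ℝ → ℝ} {μ σ p lam₀ η₂ η' : ℝ}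
    (hc : ContinuousOn c (Icc a b)) (hc' : ∀ t ∈ Ico a b, HasDerivWithinAt c (c' t) (Ici t) t)
    (hb₀ : ContinuousOn b₀ (Icc a b)) (hμ : 0 ≤ μ)
    (bound : ∀ t ∈ Ico a b, lam₀ + μ * b₀ t * c t - η₂ ≤ c' t)
    (hblo : ∀ t ∈ Icc a b, σ * (t - a) - p ≤ b₀ t) (hbhi : ∀ t ∈ Icc a b, b₀ t ≤ σ * (t - a) + p)
    (hσ : 0 ≤ σ) (hp : 0 ≤ p) (hca : -η' ≤ c a) (hle : η₂ ≤ lam₀) {t w : ℝ} (ht : t ∈ Icc a b)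
    (hw : 0 < w) (hwt : w ≤ t - a)
    (hX : 0 ≤ (lam₀ - η₂) * w * Real.exp (-(μ * (σ * w ^ 2 / 2 + p * w))) - η') :
    Real.exp (μ * (σ * (t - a) ^ 2 / 2 - p * (t - a))) *
        ((lam₀ - η₂) * w * Real.exp (-(μ * (σ * w ^ 2 / 2 + p * w))) - η') ≤ c t := by
  have hβc : ContinuousOn (fun s => μ * b₀ s) (Icc a b) := continuousOn_const.mul hb₀
  have hcomp := linearComparison_le hc hc' (A := fun _ => lam₀ - η₂) (β := fun s => μ * b₀ s)
    continuousOn_const hβc (fun s hs => by have := bound s hs; linarith) ht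
  set B : ℝ → ℝ := fun s => ∫ u in a..s, μ * b₀ u with hB
  have hBc : ContinuousOn B (Icc a b) := continuousOn_primitive_Icc hβc
  -- affine bounds on `B`
  have hBlo : ∀ s ∈ Icc a b, μ * (σ * (s - a) ^ 2 / 2 - p * (s - a)) ≤ B s := by
    intro s hs
    have h := primitive_mono hβc (ℓ := fun u => μ * (σ * (u - a) + -p)) (by fun_prop) hs
      (fun u hu => mul_le_mul_of_nonneg_left (by linarith [hblo u ⟨hu.1, hu.2.trans hs.2⟩]) hμ)
    have hI : ∫ u in a..s, μ * (σ * (u - a) + -p) = μ * (σ * (s - a) ^ 2 / 2 - p * (s - a)) := by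
      rw [intervalIntegral.integral_const_mul, integral_affine]; ring
    rw [hI] at h; exact h
  have hBhi : ∀ s ∈ Icc a b, B s ≤ μ * (σ * (s - a) ^ 2 / 2 + p * (s - a)) := by
    intro s hs
    have h := primitive_mono (β := fun u => μ * (σ * (u - a) + p)) (ℓ := fun u => μ * b₀ u)
      (by fun_prop) hβc hs
      (fun u hu => mul_le_mul_of_nonneg_left (hbhi u ⟨hu.1, hu.2.trans hs.2⟩) hμ)
    have hI : ∫ u in a..s, μ * (σ * (u - a) + p) = μ * (σ * (s - a) ^ 2 / 2 + p * (s - a)) := by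
      rw [intervalIntegral.integral_const_mul, integral_affine]
    rw [hI] at h; exact h
  -- the forcing integral over the window `[a, a + w]`
  have haw : a + w ∈ Icc a t := ⟨by linarith, by linarith⟩
  have hpos : 0 ≤ lam₀ - η₂ := by linarith
  have hwc : ContinuousOn (fun s => (fun _ : ℝ => lam₀ - η₂) s * Real.exp (-B s)) (Icc a b) :=
    continuousOn_const.mul hBc.neg.rexp
  have hwi : ∀ {x y : ℝ}, a ≤ x → x ≤ y → y ≤ b →
      IntervalIntegrable (fun s => (fun _ : ℝ => lam₀ - η₂) s * Real.exp (-B s)) volume x y :=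
    fun hx hxy hy => (hwc.mono (Icc_subset_Icc hx hy)).intervalIntegrable_of_Icc hxy
  have hwnn : ∀ s ∈ Icc a b, 0 ≤ (fun _ : ℝ => lam₀ - η₂) s * Real.exp (-B s) :=
    fun s _ => mul_nonneg hpos (Real.exp_pos _).le
  have hint : (lam₀ - η₂) * w * Real.exp (-(μ * (σ * w ^ 2 / 2 + p * w))) ≤
      ∫ s in a..t, (fun _ : ℝ => lam₀ - η₂) s * Real.exp (-B s) := by
    -- restrict to the window
    have hsplit : ∫ s in a..t, (fun _ : ℝ => lam₀ - η₂) s * Real.exp (-B s) =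
        (∫ s in a..(a + w), (fun _ : ℝ => lam₀ - η₂) s * Real.exp (-B s)) +
          ∫ s in (a + w)..t, (fun _ : ℝ => lam₀ - η₂) s * Real.exp (-B s) :=
      (integral_add_adjacent_intervals (hwi le_rfl haw.1 (haw.2.trans ht.2))
        (hwi haw.1 haw.2 ht.2)).symm
    have htail : 0 ≤ ∫ s in (a + w)..t, (fun _ : ℝ => lam₀ - η₂) s * Real.exp (-B s) :=
      integral_nonneg haw.2 fun s hs => hwnn s ⟨haw.1.trans hs.1, hs.2.trans ht.2⟩
    have hwin : (lam₀ - η₂) * w * Real.exp (-(μ * (σ * w ^ 2 / 2 + p * w))) ≤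
        ∫ s in a..(a + w), (fun _ : ℝ => lam₀ - η₂) s * Real.exp (-B s) := by
      have hconst : ∫ s in a..(a + w),
          (lam₀ - η₂) * Real.exp (-(μ * (σ * w ^ 2 / 2 + p * w))) =
            (lam₀ - η₂) * w * Real.exp (-(μ * (σ * w ^ 2 / 2 + p * w))) := by
        simp only [intervalIntegral.integral_const, smul_eq_mul]; ring
      rw [← hconst]
      apply integral_mono_on haw.1 ((continuous_const).intervalIntegrable _ _)
        (hwi le_rfl haw.1 (haw.2.trans ht.2))
      intro s hs
      have hs' : s ∈ Icc a b := ⟨hs.1, hs.2.trans (haw.2.trans ht.2)⟩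
      have hBs : B s ≤ μ * (σ * w ^ 2 / 2 + p * w) := by
        refine (hBhi s hs').trans (mul_le_mul_of_nonneg_left ?_ hμ)
        have h1 : s - a ≤ w := by linarith [hs.2]
        have h0 : 0 ≤ s - a := by linarith [hs.1]
        have h2 : (s - a) ^ 2 ≤ w ^ 2 := pow_le_pow_left₀ h0 h1 2
        nlinarith [mul_le_mul_of_nonneg_left h2 hσ, mul_le_mul_of_nonneg_left h1 hp]
      show (lam₀ - η₂) * Real.exp (-(μ * (σ * w ^ 2 / 2 + p * w))) ≤
        (lam₀ - η₂) * Real.exp (-B s)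
      exact mul_le_mul_of_nonneg_left (Real.exp_le_exp.2 (by linarith)) hpos
    linarith
  have hEt : Real.exp (μ * (σ * (t - a) ^ 2 / 2 - p * (t - a))) ≤ Real.exp (B t) :=
    Real.exp_le_exp.2 (hBlo t ht)
  calc Real.exp (μ * (σ * (t - a) ^ 2 / 2 - p * (t - a))) *
        ((lam₀ - η₂) * w * Real.exp (-(μ * (σ * w ^ 2 / 2 + p * w))) - η')
      ≤ Real.exp (B t) * ((lam₀ - η₂) * w * Real.exp (-(μ * (σ * w ^ 2 / 2 + p * w))) - η') :=
        mul_le_mul_of_nonneg_right hEt hX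
    _ ≤ Real.exp (B t) * (c a + ∫ s in a..t, (fun _ : ℝ => lam₀ - η₂) s * Real.exp (-B s)) := by
        apply mul_le_mul_of_nonneg_left _ (Real.exp_pos _).le
        linarith
    _ ≤ c t := hcomp

end TaoCascade

end Literature.Analysis.FluidPDE
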